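import Summits.BirchSwinnertonDyer.BirchSwinnertonDyer.Theorems.ByReductionTypeAtTwoRankOneAtTwoOneDoorLawFirstLayerDefs
import Summits.BirchSwinnertonDyer.BirchSwinnertonDyer.Theorems.ByReductionTypeAtTwoRankOneAtTwoBigImageOddLocalOneDoorSubslicePosDisc
import Summits.BirchSwinnertonDyer.BirchSwinnertonDyer.Theorems.ByReductionTypeAtTwoRankOneAtTwoBigImageOddLocalOneDoorSubsliceNegDiscConverse
import Summits.BirchSwinnertonDyer.BirchSwinnertonDyer.Theorems.GenusKolyvaginAtTwoGenusPrimitiveSupplyAtTwoArchimedeanRowsHold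
import HarnessLib

/-!
# Route ByReductionTypeAtTwo, crux `RankOneAtTwoBigImageOddLocal` (stmt-BirchSwinnertonDyer-23715), LINE v8.17 `one_door_analytic` (final form):
# THE MANIN-FREE, SIGN-FREE COMPOSITION — PRINT⁴ + R₀⁺ + R_S + R_N + the four rank-`0` cruxes ⟹ the crux BY NAME

Lead prover seat `bsd-line-fkl-p1` g16 (2026-08-28), `--supports stmt-BirchSwinnertonDyer-23715` (helper).  THEOREMS ONLY; no definition, no named fact
introduced, no `sorry`; conditional by design (the four primary PRINT facts Gross–Zagier `gross_zagier`, Kolyvagin `kolyvagin`, modularity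
`exists_isNewformOf`, Hoffstein–Luo `HoffsteinLuo1997_exists_twist_L_one_ne_zero`, the registered residues and the route's rank-`0` cruxes are HYPOTHESES
where named).  BSD is not proved by any of this.

The statements are the lead's APPEND #2 of `Theorems/…OneDoorLawFirstLayerDefs.lean`: R₀⁺ `HeegnerExponentAtSelmerTrivialMinimalDoorAtTwo` (Kolyvagin's
conjecture at `2` with FLOATING exponent `m = v₂(c)` at every `Sel₂`-trivial minimal door of a `Ш(W)[2] = 0` slice curve, EVERY parametrisation datum —
sign-free and Manin-free; the width seat fkl-p2 g14's sign-split R⁻_float / R⁺_float in one statement), R_S `DoorIndexLawFullCAtTwoSomeDoorResidueSha`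
(`Ш(W)[2] ≠ 0`) and R_N `DoorIndexLawFullCAtTwoSomeDoorResidueNonEgg` (`Δ_W > 0` non-egg) — fkl-p2 g14's populations VERBATIM.

* §1 THE SUPPLY, sign-free and UNCONDITIONAL — `exists_selmerTrivialMinimalDoor`: on the first-layer locus (`Δ_W < 0`, or `Δ_W > 0` with `E(ℚ)` meeting
  the egg) every globally minimal `W` with `ρ̄_{W,2}` onto, `rank E(ℚ) = 1`, `E(ℚ)[2] = 0`, `Ш(W)[2] = 0` has an imaginary quadratic `K` with `d_K`
  door-admissible and MINIMAL, `(d_K, N_W) = 1`, Heegner, `#Sel₂(W^{(d_K)}) = 1` (at `Δ_W < 0`: gk2-p4's transposition supply; at `Δ_W > 0`: the silent prime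
  beyond `N_W` of `GenusKolyTwin.exists_silent_prime_heegnerField` + the PROVED egg twist law `GenusKolyArch.eggTwistLawAtTwo_holds`);
* §2 PER DATUM — **`hasLawfulDoorAtTwo_of_exponent_padicVal_at_minimalDoor`** («the door opens itself» at any exponent — a point with an exact exponent has
  infinite order, then Gross–Zagier; inlined, cf. the width seat fkl-p2 g14's `twist_entireLFunction_ne_zero_of_hasTwoDivisibilityUpToTorsion`): at a `Sel₂`-trivial
  minimal door of a `Ш(W)[2] = 0` curve a Heegner point of exponent `v₂(c)` IS a lawful door datum (`2·v₂(c) + [Δ<0] = 0 + 0 + (t + 2s) + 2·v₂(c)`;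
  `s_W = 0` by `primaryComponent_sha_two_eq_bot_of_shaTwoTrivial`, `s_d = 0` by `twist_arith_of_selmerTrivial`) — NO odd-constant hypothesis, NO bottom rung;
* §3 **`hasLawfulDoorAtTwo_of_heegnerExponent_firstLayer`**: R₀⁺ + modularity (a datum EXISTS, `nonempty_modularParametrizationData_iff_exists_isNewformOf_unconditional`)
  + §1 + §2 ⟹ every curve of the first-layer locus is LAWFUL; **`bsdp_two_of_heegnerExponent_firstLayer`** (+ the rank-`0` cruxes);
* §4 **THE v8.17 COMPOSITION `rankOneAtTwoBigImageOddLocal_of_heegnerExponent_of_residueSha_of_residueNonEgg`**: Gross–Zagier, Kolyvagin, modularity,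
  Hoffstein–Luo (PRINT⁴ — Gross 1991 Prop. 3.7 (2) and the bottom rung U₀ are NOT on the path) + R₀⁺ + R_S + R_N + the four `…RankZeroAtTwo` cruxes ⟹
  `RankOneAtTwoBigImageOddLocal` BY NAME (trichotomy `¬Ш[2]=0` / first-layer locus / `Δ>0` non-egg; `Δ_W ≠ 0`);
* LOSSLESSNESS (crux ⟹ R₀⁺ ∧ R_S ∧ R_N modulo the rank-`0` `2`-converse) is the sequel `Theorems/…OneDoorSubsliceFirstLayerManinFreeLossless.lean` (kept apart so
  that this composition file — imported by the crux skeleton — does not sit in the import cone of route TwoAdicConverse's thesis file).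

References: [Zhang2014CJM] Thm. 1.1 (shape, p ≥ 5); [GrossLMS1991] Conj. 1.2, §3, §10; [Kolyvagin1990] Thm. A; [GrossZagier1986] Thm. I.6.3, V.§2;
[Kramer1981] Prop. 3, Prop. 6; [MazurRubin2010] Prop. 3.3, Cor. 3.4 (i); [BhargavaSkinnerZhang2014] Thm. 5 (d).
-/

set_option autoImplicit false
-- the Theorems namespace of this sub repeats the summit name by design (D-0017 nested layout)
set_option linter.dupNamespace false

noncomputable section

open scoped Classical

namespace Summit.BirchSwinnertonDyer.BirchSwinnertonDyer.Theorems.RankOneAtTwoOneDoor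

open WeierstrassCurve NumberField Literature.NumberTheory.EllipticCurves Literature.NumberTheory.EllipticCurves.ModularForms
  Summit.BirchSwinnertonDyer.Rank1Residual.F1Sign2
  Summit.BirchSwinnertonDyer.Rank1Residual.F1Sign2.TranspositionDoor
  Summit.BirchSwinnertonDyer.BirchSwinnertonDyer.Theses.ByReductionTypeAtTwo
open Summit.BirchSwinnertonDyer.BirchSwinnertonDyer.Theorems.GenusKolyTwin (exists_silent_prime_heegnerField)
open Summit.BirchSwinnertonDyer.BirchSwinnertonDyer.Theorems.GenusKolyArch (eggTwistLawAtTwo_holds)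
open Summit.BirchSwinnertonDyer.BirchSwinnertonDyer.Theorems.GenusKolyTransp (exists_transpAdmissible_door_twistSelmerTwoCard_eq_one)

/-! ### §1 The supply of `Sel₂`-trivial minimal doors, both signs, unconditional -/

/-- **AT `Δ_W > 0`: A `Sel₂`-TRIVIAL MINIMAL HEEGNER DOOR FOR EVERY RANK-ONE `Ш[2] = 0` EGG CURVE WITH `ρ̄_{W,2}` ONTO** (unconditional): a silent prime
`ℓ > N_W` (`GenusKolyTwin.exists_silent_prime_heegnerField`) gives `K = ℚ(√−ℓ)` with `d_K = −ℓ` desc-admissible (hence door-admissible and minimal, `t = s = 0`),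
coprime to `N_W`, Heegner; `#Sel₂(W^{(d_K)}) = 1` by the PROVED egg twist law. [cite: Kramer1981, Prop. 6] [cite: MazurRubin2010, Prop. 3.3] -/
theorem exists_selmerTrivialMinimalDoor_posDisc (W : WeierstrassCurve ℚ) [W.IsElliptic] [W.IsGloballyMinimal] [NeZero (W.conductorNorm ℤ)]
    (hsurj2 : W.HasSurjectiveModNGaloisRep 2) (hΔ : 0 < W.Δ) (hT : NoRationalTwoTorsion W) (hrk : W.mordellWeilRank = 1) (hSha : ShaTwoTrivial W)
    (hmeets : MeetsEgg W) :
    ∃ (K : Type) (_ : Field K) (_ : NumberField K), IsImaginaryQuadratic K ∧ DoorAdmissible W (NumberField.discr K) ∧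
      transpCount W (NumberField.discr K) + 2 * identCount W (NumberField.discr K) = (if W.Δ < 0 then 1 else 0) ∧
      Nat.Coprime (NumberField.discr K).natAbs (W.conductorNorm ℤ) ∧ SatisfiesHeegnerHypothesis (W.conductorNorm ℤ) K ∧
      twistSelmerTwoCard W (NumberField.discr K) = 1 := by
  obtain ⟨ℓ, hNℓ, hℓ, -, -, -, hDA, -, K, iF, iN, hK, hd, -, -, hHN, -, -, -⟩ :=
    exists_silent_prime_heegnerField W hΔ hsurj2 (W.conductorNorm ℤ)
  rw [← hd] at hDA
  have hcop : Nat.Coprime (NumberField.discr K).natAbs (W.conductorNorm ℤ) := by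
    rw [hd, Int.natAbs_neg, Int.natAbs_natCast]
    refine (Nat.Prime.coprime_iff_not_dvd hℓ).mpr fun hdvd => ?_
    exact absurd (Nat.le_of_dvd (Nat.pos_of_ne_zero (NeZero.ne _)) hdvd) (not_le.mpr hNℓ)
  exact ⟨K, iF, iN, hK, ANg16.doorAdmissible_of_descAdmissible W hDA, minimal_of_descAdmissible_of_pos W hΔ hDA, hcop, hHN,
    (eggTwistLawAtTwo_holds W hΔ hT hrk hSha (NumberField.discr K) hDA).1 hmeets⟩

/-- **AT `Δ_W < 0`: A `Sel₂`-TRIVIAL MINIMAL HEEGNER DOOR FOR EVERY RANK-ONE `Ш[2] = 0` CURVE WITH `E(ℚ)[2] = 0`** (unconditional): gk2-p4's transposition supply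
`GenusKolyTransp.exists_transpAdmissible_door_twistSelmerTwoCard_eq_one` (Mazur–Rubin 2010 Cor. 3.4 (i) at one `T`-place), read as a door-admissible minimal door
(`ANg16.doorAdmissible_of_transpAdmissible`, `minimal_of_transpAdmissible`). [cite: MazurRubin2010, Prop. 3.3 and Cor. 3.4 (i)] [cite: Kramer1981, Prop. 3] -/
theorem exists_selmerTrivialMinimalDoor_negDisc (W : WeierstrassCurve ℚ) [W.IsElliptic] [W.IsGloballyMinimal] [NeZero (W.conductorNorm ℤ)]
    (hΔ : W.Δ < 0) (hT : NoRationalTwoTorsion W) (hrk : W.mordellWeilRank = 1) (hSha : ShaTwoTrivial W) :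
    ∃ (K : Type) (_ : Field K) (_ : NumberField K), IsImaginaryQuadratic K ∧ DoorAdmissible W (NumberField.discr K) ∧
      transpCount W (NumberField.discr K) + 2 * identCount W (NumberField.discr K) = (if W.Δ < 0 then 1 else 0) ∧
      Nat.Coprime (NumberField.discr K).natAbs (W.conductorNorm ℤ) ∧ SatisfiesHeegnerHypothesis (W.conductorNorm ℤ) K ∧
      twistSelmerTwoCard W (NumberField.discr K) = 1 := by
  obtain ⟨K, iF, iN, q₀, _, hK, htr, -, hcop, hHN, hsel⟩ := exists_transpAdmissible_door_twistSelmerTwoCard_eq_one W hΔ hT hrk hSha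
  exact ⟨K, iF, iN, hK, ANg16.doorAdmissible_of_transpAdmissible W htr, minimal_of_transpAdmissible W htr hΔ, hcop, hHN, hsel⟩

/-- **THE SUPPLY OF R₀⁺'S DOORS, SIGN-FREE** (unconditional): on the first-layer locus (`Δ_W < 0`, or `Δ_W > 0` with `E(ℚ)` meeting the egg) every globally
minimal `W` with `ρ̄_{W,2}` onto, `rank E(ℚ) = 1`, `E(ℚ)[2] = 0`, `Ш(W)[2] = 0` has an imaginary quadratic `K` with `d_K` door-admissible and minimal,
`(d_K, N_W) = 1`, Heegner, `#Sel₂(W^{(d_K)}) = 1`.  So the registered stub R₀⁺ is never vacuous on the locus. [cite: MazurRubin2010, Cor. 3.4 (i)]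
[cite: Kramer1981, Prop. 3 and Prop. 6] -/
theorem exists_selmerTrivialMinimalDoor (W : WeierstrassCurve ℚ) [W.IsElliptic] [W.IsGloballyMinimal] [NeZero (W.conductorNorm ℤ)]
    (hsurj2 : W.HasSurjectiveModNGaloisRep 2) (hT : NoRationalTwoTorsion W) (hrk : W.mordellWeilRank = 1) (hSha : ShaTwoTrivial W)
    (hsign : W.Δ < 0 ∨ (0 < W.Δ ∧ MeetsEgg W)) :
    ∃ (K : Type) (_ : Field K) (_ : NumberField K), IsImaginaryQuadratic K ∧ DoorAdmissible W (NumberField.discr K) ∧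
      transpCount W (NumberField.discr K) + 2 * identCount W (NumberField.discr K) = (if W.Δ < 0 then 1 else 0) ∧
      Nat.Coprime (NumberField.discr K).natAbs (W.conductorNorm ℤ) ∧ SatisfiesHeegnerHypothesis (W.conductorNorm ℤ) K ∧
      twistSelmerTwoCard W (NumberField.discr K) = 1 := by
  rcases hsign with hΔ | ⟨hΔ, hmeets⟩
  · exact exists_selmerTrivialMinimalDoor_negDisc W hΔ hT hrk hSha
  · exact exists_selmerTrivialMinimalDoor_posDisc W hsurj2 hΔ hT hrk hSha hmeets

/-! ### §2 Per datum: a Heegner point of exponent `v₂(c)` at a `Sel₂`-trivial minimal door is a lawful door datum -/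

/-- **AT A `Sel₂`-TRIVIAL MINIMAL DOOR OF A `Ш(W)[2] = 0` CURVE, A HEEGNER POINT OF EXPONENT `v₂(c)` IS A LAWFUL DOOR DATUM** (modulo Gross–Zagier and
modularity, for analytic rank `1`): the door opens itself; `s_W = 0` (`Ш(W)[2] = 0 ⟹ Ш(W)[2^∞] = ⊥`, `primaryComponent_sha_two_eq_bot_of_shaTwoTrivial`),
`s_d = 0` on a globally minimal model of the twist (`twist_arith_of_selmerTrivial`), `t + 2s = [Δ_W<0]` (minimality), so the AN-28c identity reads
`2·v₂(c) + [Δ_W<0] = 0 + 0 + [Δ_W<0] + 2·v₂(c)`.  NO odd-constant hypothesis, NO bottom rung, NO Gross 3.7 (2).  The sign-free form of the width seat's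
`hasLawfulDoorAtTwo_of_exponent_eq_padicVal_at` (transposition doors).  CONDITIONAL by design; BSD is not proved by this. [cite: GrossZagier1986, Thm. I.6.3 and V.§2]
[cite: GrossLMS1991, Conj. 1.2 and §3] [cite: Kramer1981, Prop. 3 and Prop. 6] -/
theorem hasLawfulDoorAtTwo_of_exponent_padicVal_at_minimalDoor (hnf : exists_isNewformOf)
    (W : WeierstrassCurve ℚ) [W.IsElliptic] [W.IsGloballyMinimal] [NeZero (W.conductorNorm ℤ)] (hr : W.analyticRank = 1) (hSha : ShaTwoTrivial W)
    (K : Type) [iF : Field K] [iN : NumberField K] (hK : IsImaginaryQuadratic K) (hGZ : gross_zagier (W.conductorNorm ℤ) W K)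
    (hadm : DoorAdmissible W (NumberField.discr K))
    (hmin : transpCount W (NumberField.discr K) + 2 * identCount W (NumberField.discr K) = (if W.Δ < 0 then 1 else 0))
    (hsel : twistSelmerTwoCard W (NumberField.discr K) = 1)
    (Dt : ModularParametrizationData W (W.conductorNorm ℤ)) (H : HeegnerDatum (W.conductorNorm ℤ) (NumberField.discr K))
    (ι : K →+* ℂ) (P : (W.baseChange K).toAffine.Point)
    (hP : WeierstrassCurve.Affine.Point.map ι.toRatAlgHom P = heegnerPointComplex Dt H)
    (hm : HasTwoDivisibilityUpToTorsion W K P (padicValInt 2 Dt.c)) : HasLawfulDoorAtTwo W := by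
  haveI : Fact (Nat.Prime 2) := ⟨Nat.prime_two⟩
  have hHN : SatisfiesHeegnerHypothesis (W.conductorNorm ℤ) K := satisfiesHeegnerHypothesis_of_doorAdmissible W K hK hadm
  -- the door opens itself: `P` has infinite order (a torsion `P` would make `2^m • Q`, hence `Q`, torsion, and `Q = Q − 2•0` twice a point
  -- modulo torsion), so `L'(E/K,1) ≠ 0` by Gross–Zagier and `L(W^{(d_K)},1) ≠ 0` by `L'(E/K,1) = L'(E,1)·L(W^{(d_K)},1)` (modularity)
  have hPinf : ¬ IsOfFinAddOrder P := by
    intro hPfin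
    obtain ⟨Q, hPQ, hQ⟩ := id hm
    apply hQ
    refine ⟨0, ?_⟩
    rw [smul_zero, sub_zero]
    have hPt : P ∈ AddCommGroup.torsion (W.baseChange K).toAffine.Point := (AddCommGroup.mem_torsion _).mpr hPfin
    have h2Q : (2 ^ padicValInt 2 Dt.c) • Q ∈ AddCommGroup.torsion (W.baseChange K).toAffine.Point := by
      have h' : (2 ^ padicValInt 2 Dt.c) • Q = P - (P - (2 ^ padicValInt 2 Dt.c) • Q) := by abel
      rw [h']
      exact (AddCommGroup.torsion (W.baseChange K).toAffine.Point).sub_mem hPt hPQ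
    rw [AddCommGroup.mem_torsion] at h2Q ⊢
    obtain ⟨k, hk, hkQ⟩ := (isOfFinAddOrder_iff_nsmul_eq_zero).mp h2Q
    refine (isOfFinAddOrder_iff_nsmul_eq_zero).mpr ⟨k * 2 ^ padicValInt 2 Dt.c, Nat.mul_pos hk (Nat.two_pow_pos _), ?_⟩
    rw [mul_nsmul', hkQ]
  have hLt : (W.quadraticTwist (NumberField.discr K : ℚ)).entireLFunction 1 ≠ 0 := by
    have hmod : hasEntireLFunction_rat := hasEntireLFunction_rat_of_exists_isNewformOf hnf
    have hPH : IsHeegnerPoint (W.conductorNorm ℤ) W K P := ⟨Dt, H, ι, hP⟩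
    have hLK : LDerivEK W K ≠ 0 := (lDerivEK_ne_zero_iff_not_isOfFinAddOrder W (W.conductorNorm ℤ) K hGZ hK hHN hPH).mpr hPinf
    have hL0 : W.entireLFunction 1 = 0 := entireLFunction_one_eq_zero_of_analyticRank_eq_one hr
    rw [lDerivEK_eq_deriv_mul_of_entireLFunction_one_eq_zero hmod W K hL0] at hLK
    exact (mul_ne_zero_iff.mp hLK).2
  -- a globally minimal model of the twist, and its `Ш[2^∞] = ⊥`
  have hD0 : (NumberField.discr K : ℚ) ≠ 0 := by exact_mod_cast NumberField.discr_ne_zero K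
  haveI hEt : (W.quadraticTwist (NumberField.discr K : ℚ)).IsElliptic := W.isElliptic_quadraticTwist hD0
  obtain ⟨Cd, hCd⟩ := hasGlobalMinimalModel_rat_holds (W.quadraticTwist (NumberField.discr K : ℚ))
  haveI := hCd
  obtain ⟨-, -, hbotd⟩ := twist_arith_of_selmerTrivial W hD0 hsel (Cd • W.quadraticTwist (NumberField.discr K : ℚ)) Cd rfl
  have hsW : padicValNat 2 (Nat.card (AddCommGroup.primaryComponent W.sha 2)) = 0 :=
    padicValNat_card_primaryComponent_sha_two_eq_zero_of_shaTwoTrivial W hSha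
  have hsd : padicValNat 2 (Nat.card (AddCommGroup.primaryComponent (Cd • W.quadraticTwist (NumberField.discr K : ℚ)).sha 2)) = 0 := by
    rw [hbotd, AddSubgroup.card_bot]; simp
  unfold HasLawfulDoorAtTwo
  refine ⟨K, iF, iN, hK, hadm, hLt, Dt, H, ι, P, Cd • W.quadraticTwist (NumberField.discr K : ℚ), inferInstance, hCd, Cd, hP, rfl,
    padicValInt 2 Dt.c, hm, ?_⟩
  rw [hsW, hsd]
  omega

/-! ### §3 Under R₀⁺ every curve of the first-layer locus is lawful (Manin-free) -/

/-- **UNDER R₀⁺, EVERY CURVE OF THE SLICE WITH `Ш(W)[2] = 0` AND (`Δ_W < 0`, OR `Δ_W > 0` WITH `E(ℚ)` MEETING THE EGG) ADMITS A LAWFUL DOOR DATUM** —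
modulo Gross–Zagier, Kolyvagin, modularity, Hoffstein–Luo (for `rank E(ℚ) = 1` and for a parametrisation datum, which EXISTS by modularity alone:
`nonempty_modularParametrizationData_iff_exists_isNewformOf_unconditional` — ANY constant).  Door by §1, `K`-rational Heegner point by
`heegnerPointComplex_mem_range_map_holds`, exponent `v₂(c)` by R₀⁺, lawful by §2.  NO odd-constant datum, NO `S_manin`, NO bottom rung.  CONDITIONAL on R₀⁺
and the four printed facts; BSD is not proved by this. [cite: Zhang2014CJM, Thm. 1.1 (shape)] [cite: GrossZagier1986, Thm. I.6.3 and V.§2]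
[cite: Kramer1981, Prop. 3 and Prop. 6] [cite: MazurRubin2010, Cor. 3.4 (i)] -/
theorem hasLawfulDoorAtTwo_of_heegnerExponent_firstLayer (h : HeegnerExponentAtSelmerTrivialMinimalDoorAtTwo)
    (hGZ : ∀ (N : ℕ) [NeZero N] (W : WeierstrassCurve ℚ) (K : Type) [Field K] [NumberField K], gross_zagier N W K)
    (hKo : ∀ (N : ℕ) [NeZero N] (W : WeierstrassCurve ℚ) (K : Type) [Field K] [NumberField K], kolyvagin N W K)
    (hnf : exists_isNewformOf) (hHL : HoffsteinLuo1997_exists_twist_L_one_ne_zero)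
    (W : WeierstrassCurve ℚ) [W.IsElliptic] [W.IsGloballyMinimal] [NeZero (W.conductorNorm ℤ)]
    (hCM : ¬ W.HasCM) (hsurj : ∀ n : ℕ, W.HasSurjectiveModNGaloisRep ((2 ^ n : ℕ) : ℤ)) (hT : Odd W.torsionOrder)
    (hc : Odd W.tamagawaProduct) (hr : W.analyticRank = 1) (hSha : ShaTwoTrivial W) (hsign : W.Δ < 0 ∨ (0 < W.Δ ∧ MeetsEgg W)) :
    HasLawfulDoorAtTwo W := by
  have hsurj2 : W.HasSurjectiveModNGaloisRep 2 := by simpa using hsurj 1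
  have hT2 : NoRationalTwoTorsion W := noRationalTwoTorsion_of_odd_torsionOrder W hT
  have hrk : W.mordellWeilRank = 1 := (mordellWeilRank_eq_one_of_analyticRank_eq_one_of_isGloballyMinimal hGZ hKo hnf hHL W hr).1
  obtain ⟨K, iF, iN, hK, hadm, hmin, hcop, hHN, hsel⟩ := exists_selmerTrivialMinimalDoor W hsurj2 hT2 hrk hSha hsign
  -- ANY parametrisation datum (modularity), a Heegner datum, an embedding, the `K`-rational Heegner point
  obtain ⟨Dt⟩ := (nonempty_modularParametrizationData_iff_exists_isNewformOf_unconditional.mpr hnf) W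
  obtain ⟨H, -⟩ :=
    nonempty_heegnerDatum_holds (W.conductorNorm ℤ) K hK (exists_dvd_sq_sub_discr_holds (W.conductorNorm ℤ) K hK hHN).choose_spec
  obtain ⟨ι⟩ : Nonempty (K →+* ℂ) := inferInstance
  obtain ⟨P, hP⟩ := heegnerPointComplex_mem_range_map_holds (W.conductorNorm ℤ) W K hK hHN Dt H ι
  -- R₀⁺: exponent `v₂(c)`
  have hm : HasTwoDivisibilityUpToTorsion W K P (padicValInt 2 Dt.c) :=
    h W hCM hsurj hT hc hr hSha K hK hadm hmin hcop hHN hsel Dt H ι P hP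
  exact hasLawfulDoorAtTwo_of_exponent_padicVal_at_minimalDoor hnf W hr hSha K hK (hGZ _ W K) hadm hmin hsel Dt H ι P hP hm

/-- **UNDER R₀⁺, `BSDp W 2` ON THE WHOLE FIRST-LAYER LOCUS** {slice, `Ш(W)[2] = 0`, `Δ_W < 0 ∨ MeetsEgg W`}, modulo the four primary printed facts and the
route's four rank-`0` cruxes BY NAME (`bsdp_two_of_hasLawfulDoorAtTwo_of_rankZero_cruxes`): one lawful datum gives `BSD₂(W)`.  Compared with v8.16's
`bsdp_two_of_heegnerNonDivisibility_negDisc` / `bsdp_two_of_heegnerPointOnEggAtTwo_posDisc`: no odd-constant datum, no Gross 3.7 (2), one sign-free residue.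
CONDITIONAL by design; BSD is not proved by this. [cite: Zhang2014CJM, Thm. 1.1] [cite: GrossLMS1991, Conj. 1.2 and §3] [cite: Kolyvagin1990, Thm. A]
[cite: GrossZagier1986, Thm. I.6.3 and V.§2] -/
theorem bsdp_two_of_heegnerExponent_firstLayer (h : HeegnerExponentAtSelmerTrivialMinimalDoorAtTwo)
    (hGZ : ∀ (N : ℕ) [NeZero N] (W : WeierstrassCurve ℚ) (K : Type) [Field K] [NumberField K], gross_zagier N W K)
    (hKo : ∀ (N : ℕ) [NeZero N] (W : WeierstrassCurve ℚ) (K : Type) [Field K] [NumberField K], kolyvagin N W K)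
    (hnf : exists_isNewformOf) (hHL : HoffsteinLuo1997_exists_twist_L_one_ne_zero)
    (hZ4 : GoodOrdinaryRankZeroAtTwo ∧ MultiplicativeRankZeroAtTwo ∧ SupersingularRankZeroAtTwo ∧ AdditiveRankZeroAtTwo)
    (W : WeierstrassCurve ℚ) [W.IsElliptic] [W.IsGloballyMinimal] [NeZero (W.conductorNorm ℤ)]
    (hCM : ¬ W.HasCM) (hsurj : ∀ n : ℕ, W.HasSurjectiveModNGaloisRep ((2 ^ n : ℕ) : ℤ)) (hT : Odd W.torsionOrder)
    (hc : Odd W.tamagawaProduct) (hr : W.analyticRank = 1) (hSha : ShaTwoTrivial W) (hsign : W.Δ < 0 ∨ (0 < W.Δ ∧ MeetsEgg W)) : BSDp W 2 :=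
  bsdp_two_of_hasLawfulDoorAtTwo_of_rankZero_cruxes hGZ hKo hnf hHL hZ4 W hCM hT hc hr
    (hasLawfulDoorAtTwo_of_heegnerExponent_firstLayer h hGZ hKo hnf hHL W hCM hsurj hT hc hr hSha hsign)

/-! ### §4 THE v8.17 COMPOSITION (Manin-free, sign-free, no Gross 3.7 (2)) -/

/-- **EVERY CURVE OF THE SLICE IS LAWFUL under R₀⁺ ∧ R_S ∧ R_N** (modulo the four primary printed facts): trichotomy — `Ш(W)[2] ≠ 0` (R_S), or `Ш(W)[2] = 0`
and (`Δ_W < 0`, or `Δ_W > 0` on the egg: §3 from R₀⁺; `Δ_W > 0` off the egg: R_N; `Δ_W = 0` excluded).  This is the hypothesis-free form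
`DoorIndexLawFullCAtTwoSomeDoor` of the lead's APPEND #8.  CONDITIONAL by design. [cite: GrossLMS1991, Conj. 1.2, §3 and §10] [cite: Zhang2014CJM, Thm. 1.1] -/
theorem doorIndexLawFullCAtTwoSomeDoor_of_heegnerExponent_of_residueSha_of_residueNonEgg
    (hGZ : ∀ (N : ℕ) [NeZero N] (W : WeierstrassCurve ℚ) (K : Type) [Field K] [NumberField K], gross_zagier N W K)
    (hKo : ∀ (N : ℕ) [NeZero N] (W : WeierstrassCurve ℚ) (K : Type) [Field K] [NumberField K], kolyvagin N W K)
    (hnf : exists_isNewformOf) (hHL : HoffsteinLuo1997_exists_twist_L_one_ne_zero)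
    (h : HeegnerExponentAtSelmerTrivialMinimalDoorAtTwo) (hS : DoorIndexLawFullCAtTwoSomeDoorResidueSha) (hN : DoorIndexLawFullCAtTwoSomeDoorResidueNonEgg) :
    DoorIndexLawFullCAtTwoSomeDoor := by
  intro W _ _ _ hCM hsurj hT hc hr
  by_cases hSha : ShaTwoTrivial W
  · rcases lt_trichotomy W.Δ 0 with hΔ | hΔ0 | hΔ
    · exact hasLawfulDoorAtTwo_of_heegnerExponent_firstLayer h hGZ hKo hnf hHL W hCM hsurj hT hc hr hSha (Or.inl hΔ)
    · exact absurd hΔ0 W.isUnit_Δ.ne_zero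
    · by_cases hme : MeetsEgg W
      · exact hasLawfulDoorAtTwo_of_heegnerExponent_firstLayer h hGZ hKo hnf hHL W hCM hsurj hT hc hr hSha (Or.inr ⟨hΔ, hme⟩)
      · exact hN W hCM hsurj hT hc hr hΔ hSha hme
  · exact hS W hCM hsurj hT hc hr hSha

/-- **THE v8.17 COMPOSITION — `RankOneAtTwoBigImageOddLocal` FROM FOUR PRINTED FACTS, R₀⁺, R_S, R_N AND THE ROUTE'S FOUR RANK-`0` CRUXES.**  Every curve of
the slice is lawful (previous theorem), and one lawful datum gives `BSDp W 2` (`bsdp_two_of_hasLawfulDoorAtTwo_of_rankZero_cruxes`: the per-datum kernel iff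
`bsdp_two_iff_doorLawFullC_at_of_rank`, twin `BSD₂` from the rank-`0` cruxes).  The inputs displayed: Gross–Zagier, Kolyvagin, modularity, Hoffstein–Luo (PRINT);
R₀⁺ (Kolyvagin's conjecture at `2` with floating exponent, sign-free — CONJECTURE); R_S, R_N (the residues off the first-layer locus — CONJECTURE); the four
`…RankZeroAtTwo` cruxes (OPEN items).  Gross 1991 Prop. 3.7 (2), the bottom rung U₀, AN-13, `S_manin` and the Manin constant are NOT on the path.
CONDITIONAL by design; BSD is not proved by this. [cite: Zhang2014CJM, Thm. 1.1 (shape; p ≥ 5 in print)] [cite: GrossLMS1991, Conj. 1.2, §3 and §10]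
[cite: Kolyvagin1990, Thm. A] [cite: GrossZagier1986, Thm. I.6.3 and V.§2] [cite: Kramer1981, Prop. 3 and Prop. 6] -/
theorem rankOneAtTwoBigImageOddLocal_of_heegnerExponent_of_residueSha_of_residueNonEgg
    (hGZ : ∀ (N : ℕ) [NeZero N] (W : WeierstrassCurve ℚ) (K : Type) [Field K] [NumberField K], gross_zagier N W K)
    (hKo : ∀ (N : ℕ) [NeZero N] (W : WeierstrassCurve ℚ) (K : Type) [Field K] [NumberField K], kolyvagin N W K)
    (hnf : exists_isNewformOf) (hHL : HoffsteinLuo1997_exists_twist_L_one_ne_zero)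
    (h : HeegnerExponentAtSelmerTrivialMinimalDoorAtTwo) (hS : DoorIndexLawFullCAtTwoSomeDoorResidueSha) (hN : DoorIndexLawFullCAtTwoSomeDoorResidueNonEgg)
    (hZ4 : GoodOrdinaryRankZeroAtTwo ∧ MultiplicativeRankZeroAtTwo ∧ SupersingularRankZeroAtTwo ∧ AdditiveRankZeroAtTwo) :
    RankOneAtTwoBigImageOddLocal := by
  intro W _ _ hCM hsurj hT hc hr
  haveI : NeZero (W.conductorNorm ℤ) := ⟨(W.conductorNorm_pos_holds).ne'⟩
  exact bsdp_two_of_hasLawfulDoorAtTwo_of_rankZero_cruxes hGZ hKo hnf hHL hZ4 W hCM hT hc hr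
    (doorIndexLawFullCAtTwoSomeDoor_of_heegnerExponent_of_residueSha_of_residueNonEgg hGZ hKo hnf hHL h hS hN W hCM hsurj hT hc hr)

end Summit.BirchSwinnertonDyer.BirchSwinnertonDyer.Theorems.RankOneAtTwoOneDoor

end
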